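import Summits.ABC.IUTFork.Joshi.TestDictionaryCalibrationInd1Local
import HarnessLib

/-!
# Branch E TEST vs S — the calibration across places, VIII: the (Ind1)-only form at EVERY index (infinitely many places allowed)

Record file of the abc-iut cell, branch E (rung LADDER-ABC:A2.E; seat abc-iut-E-t42 gen 2, row T-42i; sequel of
`Joshi/TestDictionaryCalibrationInd1Local.lean` p443530). **No side is taken** on [IUTchIII] Cor. 3.12 or on any author; typed ≠ proved;
located, not adjudicated.

WHY. Parts V/VII characterised place-separability through SINGLE-place components, which needs FINITELY many places (a place-by-place
assembly is then a finite product). The genuine index of an initial Θ-datum has `V_ℚ` = ALL places of `ℚ` — infinitely many. THIS FILE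
gives the index-general form, under abc-iut-c312's group hypotheses (HI), (HS), (HN) of `Thm311SigProofs` (product decomposition
`closure_eq_Ind2Family_mul_Ind1Family`: every indeterminacy is ONE (Ind1)-family followed by ONE (Ind2)-family):
* `Ind1PlaceSeparable L` := a family assembled place by place from (Ind1)-FAMILIES lies in `⟨(Ind1) ∪ (Ind2)⟩` (TEST SHAPE, never asserted);
* `assemble_mem_Ind2Family` — (Ind2) is a product over the places: assemblies of (Ind2)-families are (Ind2)-families, at every index;
* **`indPlaceSeparable_iff_ind1PlaceSeparable`** (HI, HS, HN; ANY index): `IndPlaceSeparable L ↔ Ind1PlaceSeparable L` — decompose each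
  constituent as `Φ₂ · Φ₁`, assemble the two layers separately;
* `TwoPlace.not_ind1PlaceSeparable` — the rigid two-place instance.
So at every index — in particular at genuine, infinitely-many-place indices — X-01's hypothesis set ⟺ S (part I §2) holds exactly when
the procession automorphisms (Ind1) may be chosen independently place by place modulo `⟨(Ind1) ∪ (Ind2)⟩`; Ism plays no role.
[claim: Mochizuki2012, status: disputed] [claim: Joshi2024ATS3, status: disputed] [cite: DupuyHilado2025, §4.11]
-/

noncomputable section

open Set

namespace Summit.ABC.IUTFork.Joshi

open Thm311 Cor312 Cor312Vol Literature.IUT.LogThetaLattice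
open scoped Pointwise

section Ind1Assembly

variable {T : ThetaIndex} (L : LogShells T)

/-- The place-by-place ASSEMBLY of a place-indexed family of packet-automorphism families. [folklore] -/
def assemble (Φ : T.VQ → L.PacketAut) : L.PacketAut := fun j vQ => Φ vQ j vQ

/-- Assembly is multiplicative. [folklore] -/
theorem assemble_mul (Φ Ψ : T.VQ → L.PacketAut) : assemble L (Φ * Ψ) = assemble L Φ * assemble L Ψ := rfl

/-- **`Ind1PlaceSeparable L`** — a family assembled place by place from (Ind1)-FAMILIES lies in `⟨(Ind1) ∪ (Ind2)⟩` («the procession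
automorphism may be chosen independently at each place, modulo indeterminacies»). TEST SHAPE on the signature, never asserted; no author
claims it ([IUTchIII] Thm. 3.11 (i) p. 154: ONE automorphism of the procession; `LogShells.Ind1`). [claim: Mochizuki2012, status: disputed] -/
@[claim "Mochizuki2012" "disputed"]
def Ind1PlaceSeparable : Prop :=
  ∀ Φ : T.VQ → L.PacketAut, (∀ vQ, Φ vQ ∈ L.Ind1Family) → assemble L Φ ∈ Subgroup.closure (L.Ind1Family ∪ L.Ind2Family)

variable {L}

/-- **(Ind2) is a product over the places**: an assembly of (Ind2)-families is an (Ind2)-family — at EVERY index. [claim: Mochizuki2012, status: disputed] -/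
theorem assemble_mem_Ind2Family {Φ : T.VQ → L.PacketAut} (hΦ : ∀ vQ, Φ vQ ∈ L.Ind2Family) : assemble L Φ ∈ L.Ind2Family :=
  fun j vQ => hΦ vQ j vQ

/-- Place-separable ⟹ (Ind1)-place-separable (restriction; every index, no hypothesis). [folklore] -/
theorem ind1PlaceSeparable_of_indPlaceSeparable (hsep : IndPlaceSeparable L) : Ind1PlaceSeparable L :=
  fun Φ hΦ => hsep Φ fun vQ => Subgroup.subset_closure (Or.inl (hΦ vQ))

/-- **`indPlaceSeparable_iff_ind1PlaceSeparable` — the (Ind1)-only form at EVERY index** (under (HI), (HS), (HN)): decompose each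
constituent `Φ_{v_ℚ} = Φ₂ · Φ₁` (abc-iut-c312 `closure_eq_Ind2Family_mul_Ind1Family`), assemble the (Ind2)-layer (always an
(Ind2)-family) and the (Ind1)-layer (a member by hypothesis) separately. [claim: Mochizuki2012, status: disputed] -/
theorem indPlaceSeparable_iff_ind1PlaceSeparable
    (hS : ∀ v, ∀ a ∈ L.stripAut v, ∀ b ∈ L.stripAut v, a * b ∈ L.stripAut v) (hS' : ∀ v, ∀ a ∈ L.stripAut v, a⁻¹ ∈ L.stripAut v)
    (hN : ∀ v, ∀ a ∈ L.stripAut v, ∀ g ∈ L.ism v, a * g * a⁻¹ ∈ L.ism v)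
    (hI : ∀ v, ∀ a ∈ L.ism v, ∀ b ∈ L.ism v, a * b ∈ L.ism v) (hI' : ∀ v, ∀ a ∈ L.ism v, a⁻¹ ∈ L.ism v) :
    IndPlaceSeparable L ↔ Ind1PlaceSeparable L := by
  refine ⟨ind1PlaceSeparable_of_indPlaceSeparable, fun h1 Φ hΦ => ?_⟩
  have hdec := LogShells.closure_eq_Ind2Family_mul_Ind1Family (hS := hS) (hS' := hS') (hN := hN) hI hI'
  have hΦ' : ∀ vQ, Φ vQ ∈ L.Ind2Family * L.Ind1Family := fun vQ => by rw [← hdec]; exact hΦ vQ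
  choose Φ₂ hΦ₂ Φ₁ hΦ₁ hprod using fun vQ => Set.mem_mul.1 (hΦ' vQ)
  have heq : (fun j vQ => Φ vQ j vQ) = assemble L Φ₂ * assemble L Φ₁ := by
    funext j vQ
    rw [Pi.mul_apply, Pi.mul_apply, ← hprod vQ]
    rfl
  rw [heq]
  exact mul_mem (Subgroup.subset_closure (Or.inr (assemble_mem_Ind2Family hΦ₂))) (h1 Φ₁ hΦ₁)

/-- At FINITE indices the two (Ind1)-conditions of parts VII and VIII agree (both are equivalent to place-separability under
(HI), (HS), (HN)). [folklore] -/
theorem ind1PlaceSeparable_iff_ind1PlaceComponentsMem [Finite T.VQ]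
    (hS : ∀ v, ∀ a ∈ L.stripAut v, ∀ b ∈ L.stripAut v, a * b ∈ L.stripAut v) (hS' : ∀ v, ∀ a ∈ L.stripAut v, a⁻¹ ∈ L.stripAut v)
    (hN : ∀ v, ∀ a ∈ L.stripAut v, ∀ g ∈ L.ism v, a * g * a⁻¹ ∈ L.ism v)
    (hI : ∀ v, ∀ a ∈ L.ism v, ∀ b ∈ L.ism v, a * b ∈ L.ism v) (hI' : ∀ v, ∀ a ∈ L.ism v, a⁻¹ ∈ L.ism v) :
    Ind1PlaceSeparable L ↔ Ind1PlaceComponentsMem L :=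
  (indPlaceSeparable_iff_ind1PlaceSeparable hS hS' hN hI hI').symm.trans
    (indPlaceSeparable_iff_ind1PlaceComponentsMem hS hS' hN hI hI')

end Ind1Assembly

/-! ## The rigid two-place instance -/

namespace TwoPlace

/-- At part I's rigid two-place shells (Ind1) is NOT place-separable: part I's `placeWitness` consists of (Ind1)-families (the identity and
the diagonal swap) and its assembly `mixed` is not a member. [claim: Mochizuki2012, status: disputed] -/
theorem not_ind1PlaceSeparable : ¬ Ind1PlaceSeparable shells := fun h =>
  mixed_not_mem (h (fun vQ => placeWitness vQ) fun vQ => by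
    cases vQ
    · exact LogShells.one_mem_Ind1Family
    · exact shells.capsPermFamily_mem_Ind1Family sw)

end TwoPlace

end Summit.ABC.IUTFork.Joshi

end
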